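import Mathlib
import Summits.SmoothPoincare4.SmoothPoincare4.Theses.SymplecticOrigami
import Literature.Geometry.Symplectic.GromovR4RelEnd

/-!
# Sketch (crux-ideate, round 1, ideator 3) — crux `GromovRecognitionRelEnd`
(stmt-SmoothPoincare4-11009; = `Literature.Geometry.Symplectic.gromov_recognitionR4_relEnd`).

First lemmas of the three idea cards, stated over existing declarations (no `sorry`):

* card `wedge-pencils-flat-chart`:   `FlatSplitChartExists`, `FlatSplitChartSuffices`,
  composition `relEnd_of_flatSplitChart` (kernel-checked, concludes the crux BY NAME);
* card `diffeo-times-r4-uniqueness`: `RelEndDiffeo` (C⁻), `R4CompactUniqueness` (U_c),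
  `Factorization` (the reduction to be proved: C⁻ → U_c → crux);
* card `jconvex-exhaustion-liouville`: `LiouvilleConicalChart`, `ConeCorrection`,
  composition `relEnd_of_conical` (kernel-checked).
-/

noncomputable section

set_option linter.dupNamespace false

open scoped Manifold ContDiff Topology
open Set

namespace Summit.SmoothPoincare4.SmoothPoincare4.Cruxes.GromovRecognitionRelEnd.SketchIdeator3

open Literature.Geometry.Kaehler Literature.Geometry.Symplectic

/-- Local notation for the model space `ℝ⁴ = EuclideanSpace ℝ (Fin 4)`. -/
local notation "E4" => EuclideanSpace ℝ (Fin 4)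

/-! ### The ten hypotheses of the crux, bundled -/

/-- The hypothesis list of `GromovRecognitionRelEnd` for the data `(M, sf, K, R, ψ, χ)`,
verbatim (π₂ = 0; `sf` smooth, closed, nondegenerate; ends clause; `ψ`, `χ` smooth and inverse
on the end; `sf = ψ^* ω₀` on `Kᶜ`). -/
def EndHyp (M : Type) [TopologicalSpace M] [ChartedSpace E4 M]
    (sf : MForm (𝓡 4) M ℝ 2) (K : Set M) (R : ℝ) (ψ : M → E4) (χ : E4 → M) : Prop :=
  (∀ x : M, Subsingleton (π_ 2 M x)) ∧ IsSmoothForm sf ∧ IsClosedForm sf ∧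
  (∀ x (v : TangentSpace (𝓡 4) x), v ≠ 0 → ∃ w, sf x ![v, w] ≠ 0) ∧
  (∀ R', R ≤ R' → IsCompact (K ∪ {x | ‖ψ x‖ ≤ R'})) ∧
  ContMDiffOn (𝓡 4) 𝓘(ℝ, E4) ∞ ψ Kᶜ ∧
  ContMDiffOn 𝓘(ℝ, E4) (𝓡 4) ∞ χ (Metric.closedBall (0 : E4) R)ᶜ ∧
  Set.BijOn ψ Kᶜ (Metric.closedBall (0 : E4) R)ᶜ ∧
  (∀ x, x ∈ Kᶜ → χ (ψ x) = x) ∧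
  (∀ x, x ∈ Kᶜ → ∀ v w, sf x ![v, w] =
    stdSymplecticForm (mfderiv (𝓡 4) 𝓘(ℝ, E4) ψ x v) (mfderiv (𝓡 4) 𝓘(ℝ, E4) ψ x w))

/-- The conclusion of the crux for `(M, sf, ψ)`: a symplectomorphism onto `(ℝ⁴, ω₀)` equal to
`ψ` off a compact set. -/
def Concl (M : Type) [TopologicalSpace M] [ChartedSpace E4 M]
    (sf : MForm (𝓡 4) M ℝ 2) (ψ : M → E4) : Prop :=
  ∃ Φ : M ≃ₘ⟮𝓡 4, 𝓡 4⟯ E4,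
    (∀ x v w, sf x ![v, w] =
      stdSymplecticForm (mfderiv (𝓡 4) 𝓘(ℝ, E4) Φ x v) (mfderiv (𝓡 4) 𝓘(ℝ, E4) Φ x w)) ∧
    ∃ K' : Set M, IsCompact K' ∧ ∀ x, x ∉ K' → Φ x = ψ x

/-- Sanity: the crux is `∀ data, EndHyp → Concl` (definitional repackaging). -/
theorem crux_iff :
    Summit.SmoothPoincare4.SmoothPoincare4.Theses.SymplecticOrigami.GromovRecognitionRelEnd ↔
    ∀ (M : Type) [TopologicalSpace M] [T2Space M] [SecondCountableTopology M]
      [ChartedSpace E4 M] [IsManifold (𝓡 4) ∞ M] [ConnectedSpace M]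
      (sf : MForm (𝓡 4) M ℝ 2) (K : Set M) (R : ℝ) (ψ : M → E4) (χ : E4 → M),
      EndHyp M sf K R ψ χ → Concl M sf ψ := by
  constructor
  · intro h M _ _ _ _ _ _ sf K R ψ χ hyp
    obtain ⟨h1, h2, h3, h4, h5, h6, h7, h8, h9, h10⟩ := hyp
    exact h M sf K R ψ χ h1 h2 h3 h4 h5 h6 h7 h8 h9 h10
  · intro h M _ _ _ _ _ _ sf K R ψ χ h1 h2 h3 h4 h5 h6 h7 h8 h9 h10
    exact h M sf K R ψ χ ⟨h1, h2, h3, h4, h5, h6, h7, h8, h9, h10⟩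

/-! ### Card `wedge-pencils-flat-chart` -/

/-- `F ∘ χ` is `C¹`-asymptotic to the identity at infinity ("flat end"): for every `ε > 0`,
beyond some radius, `‖F (χ w) − w‖ ≤ ε` and `‖D(F ∘ χ)(w) − id‖ ≤ ε`. (In the wedge model this is
just differentiability of the bi-foliation chart at the wedge `S² ∨ S²` at infinity, on which it
is the identity.) -/
def IsFlatEnd {M : Type} [TopologicalSpace M] [ChartedSpace E4 M]
    (F : M ≃ₘ⟮𝓡 4, 𝓡 4⟯ E4) (χ : E4 → M) : Prop :=
  ∀ ε > 0, ∃ r : ℝ, ∀ w : E4, r < ‖w‖ →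
    ‖F (χ w) - w‖ ≤ ε ∧
    ‖fderiv ℝ (fun w' : E4 => (F (χ w') : E4)) w - ContinuousLinearMap.id ℝ E4‖ ≤ ε

/-- Split positivity: `sf` is positive on the two foliations pulled back by `F` from the
coordinate complex lines of `ℂ² = ℝ⁴` (coordinates `(0,1)` = the `x`-line, `(2,3)` = the
`y`-line, matching `stdSymplecticForm = dx₀∧dx₁ + dx₂∧dx₃`), each leaf oriented through `F` by the
complex orientation of the line it covers: if `DF v, DF w` both lie in the `y`-line and are
independent there, then `sf(v,w)` has the sign of their `y`-area; same with `x`. -/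
def IsSplitPositive {M : Type} [TopologicalSpace M] [ChartedSpace E4 M]
    (F : M ≃ₘ⟮𝓡 4, 𝓡 4⟯ E4) (sf : MForm (𝓡 4) M ℝ 2) : Prop :=
  ∀ (x : M) (v w : TangentSpace (𝓡 4) x),
    let a : E4 := mfderiv (𝓡 4) 𝓘(ℝ, E4) F x v
    let b : E4 := mfderiv (𝓡 4) 𝓘(ℝ, E4) F x w
    (a 0 = 0 → a 1 = 0 → b 0 = 0 → b 1 = 0 → a 2 * b 3 - a 3 * b 2 ≠ 0 →
      0 < sf x ![v, w] * (a 2 * b 3 - a 3 * b 2)) ∧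
    (a 2 = 0 → a 3 = 0 → b 2 = 0 → b 3 = 0 → a 0 * b 1 - a 1 * b 0 ≠ 0 →
      0 < sf x ![v, w] * (a 0 * b 1 - a 1 * b 0))

/-- HARD STUB (J-free interface to Gromov's two pencils based at infinity / Wendl's two plane
families): under the crux hypotheses there is a diffeomorphism `F : M ≃ₘ ℝ⁴` with flat end and
split-positive foliations. Proof route: glue the wedge `S² ∨ S²` at infinity (model `S² × S²`),
run Theorem E′ (Gromov–McDuff `S² × S²` recognition with "complement of the wedge has π₂ = 0" in
place of minimality), restrict the bi-foliation chart to `M`. -/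
def FlatSplitChartExists : Prop :=
  ∀ (M : Type) [TopologicalSpace M] [T2Space M] [SecondCountableTopology M]
    [ChartedSpace E4 M] [IsManifold (𝓡 4) ∞ M] [ConnectedSpace M]
    (sf : MForm (𝓡 4) M ℝ 2) (K : Set M) (R : ℝ) (ψ : M → E4) (χ : E4 → M),
    EndHyp M sf K R ψ χ →
    ∃ F : M ≃ₘ⟮𝓡 4, 𝓡 4⟯ E4, IsFlatEnd F χ ∧ IsSplitPositive F sf

/-- SOFT STUB (first lemma of the card): a flat, split-positive chart upgrades to the relative
symplectomorphism — straight-line cutoff of `F ∘ χ` to the identity on a far shell, then the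
LINEAR path `(1−t) sf + t F₁^*ω₀` (symplectic by split positivity) and Moser with a compactly
supported primitive. -/
def FlatSplitChartSuffices : Prop :=
  ∀ (M : Type) [TopologicalSpace M] [T2Space M] [SecondCountableTopology M]
    [ChartedSpace E4 M] [IsManifold (𝓡 4) ∞ M] [ConnectedSpace M]
    (sf : MForm (𝓡 4) M ℝ 2) (K : Set M) (R : ℝ) (ψ : M → E4) (χ : E4 → M),
    EndHyp M sf K R ψ χ →
    (∃ F : M ≃ₘ⟮𝓡 4, 𝓡 4⟯ E4, IsFlatEnd F χ ∧ IsSplitPositive F sf) →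
    Concl M sf ψ

/-- Composition (kernel-checked): the two stubs give the crux BY NAME. -/
theorem relEnd_of_flatSplitChart (hE : FlatSplitChartExists) (hS : FlatSplitChartSuffices) :
    Summit.SmoothPoincare4.SmoothPoincare4.Theses.SymplecticOrigami.GromovRecognitionRelEnd := by
  rw [crux_iff]
  intro M _ _ _ _ _ _ sf K R ψ χ hyp
  exact hS M sf K R ψ χ hyp (hE M sf K R ψ χ hyp)

/-- The same composition reaches the Literature name (the SymplecticCap copy is `Iff.rfl`-equal). -/
theorem literature_relEnd_of_flatSplitChart (hE : FlatSplitChartExists)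
    (hS : FlatSplitChartSuffices) : gromov_recognitionR4_relEnd :=
  relEnd_of_flatSplitChart hE hS

/-! ### Card `diffeo-times-r4-uniqueness` -/

/-- C⁻ (what both deciding theorems actually consume): rel-end DIFFEOMORPHISM, no symplectic
conclusion. Engines: flat chart + cutoff (Cerf-free), or Eliashberg's disc filling + Cerf. -/
def RelEndDiffeo : Prop :=
  ∀ (M : Type) [TopologicalSpace M] [T2Space M] [SecondCountableTopology M]
    [ChartedSpace E4 M] [IsManifold (𝓡 4) ∞ M] [ConnectedSpace M]
    (sf : MForm (𝓡 4) M ℝ 2) (K : Set M) (R : ℝ) (ψ : M → E4) (χ : E4 → M),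
    EndHyp M sf K R ψ χ →
    ∃ Φ : M ≃ₘ⟮𝓡 4, 𝓡 4⟯ E4, ∃ K' : Set M, IsCompact K' ∧ ∀ x, x ∉ K' → Φ x = ψ x

/-- U_c(ℝ⁴) (Gromov 1985, §0.3.C / 2.4.A₂′; MS2012 §9.4): a symplectic form on the FIXED model
`ℝ⁴` equal to `ω₀` outside a ball is pulled back from `ω₀` by a diffeomorphism that is the identity
outside a ball. The crux specialised to `M = ℝ⁴`, `ψ = χ = id`. -/
def R4CompactUniqueness : Prop :=
  ∀ (om : MForm (𝓡 4) E4 ℝ 2) (R : ℝ), IsSmoothForm om → IsClosedForm om →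
    (∀ x (v : TangentSpace (𝓡 4) x), v ≠ 0 → ∃ w, om x ![v, w] ≠ 0) →
    (∀ x : E4, R < ‖x‖ → ∀ v w, om x ![v, w] = stdSymplecticForm v w) →
    ∃ Φ : E4 ≃ₘ⟮𝓡 4, 𝓡 4⟯ E4,
      (∀ x v w, om x ![v, w] =
        stdSymplecticForm (mfderiv (𝓡 4) 𝓘(ℝ, E4) Φ x v) (mfderiv (𝓡 4) 𝓘(ℝ, E4) Φ x w)) ∧
      ∃ R' : ℝ, ∀ x : E4, R' < ‖x‖ → Φ x = x

/-- The factorization to be PROVED (formal: transport `sf` to `ℝ⁴` along the C⁻-diffeomorphism,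
apply U_c, compose): crux ⟸ C⁻ ∧ U_c; conversely both factors are special cases of the crux. -/
def Factorization : Prop :=
  RelEndDiffeo → R4CompactUniqueness →
    Summit.SmoothPoincare4.SmoothPoincare4.Theses.SymplecticOrigami.GromovRecognitionRelEnd

/-! ### Card `jconvex-exhaustion-liouville` -/

/-- Output of the disc/Liouville line before the contact correction: a symplectomorphism onto
`(ℝ⁴, ω₀)` whose end mismatch `Φ ∘ χ` is HOMOGENEOUS of degree one beyond some radius (a cone over
a contactomorphism of the standard `S³`) — produced by Eliashberg's `J`-convex exhaustion with a
single minimum and conjugation of Liouville flows. -/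
def LiouvilleConicalChart : Prop :=
  ∀ (M : Type) [TopologicalSpace M] [T2Space M] [SecondCountableTopology M]
    [ChartedSpace E4 M] [IsManifold (𝓡 4) ∞ M] [ConnectedSpace M]
    (sf : MForm (𝓡 4) M ℝ 2) (K : Set M) (R : ℝ) (ψ : M → E4) (χ : E4 → M),
    EndHyp M sf K R ψ χ →
    ∃ Φ : M ≃ₘ⟮𝓡 4, 𝓡 4⟯ E4,
      (∀ x v w, sf x ![v, w] =
        stdSymplecticForm (mfderiv (𝓡 4) 𝓘(ℝ, E4) Φ x v) (mfderiv (𝓡 4) 𝓘(ℝ, E4) Φ x w)) ∧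
      ∃ r : ℝ, R ≤ r ∧ ∀ w : E4, r < ‖w‖ → ∀ t : ℝ, 1 ≤ t → Φ (χ (t • w)) = t • Φ (χ w)

/-- Cone correction (hard input inside: π₀ Cont₊(S³, ξ_st) = 0 — Eliashberg 1992 Cor. 2.4.3 with
Cerf's π₀ Diff(D³ rel ∂) = 0, the tree's leaf `cerf_pi0DiffDisc_relBoundary_three`; soft part:
lift the contact isotopy to a homogeneous Hamiltonian isotopy of `ℝ⁴ ∖ 0`, cut it off near `0`):
a symplectomorphism with conical end can be corrected to one equal to `ψ` off a compact set. -/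
def ConeCorrection : Prop :=
  ∀ (M : Type) [TopologicalSpace M] [T2Space M] [SecondCountableTopology M]
    [ChartedSpace E4 M] [IsManifold (𝓡 4) ∞ M] [ConnectedSpace M]
    (sf : MForm (𝓡 4) M ℝ 2) (K : Set M) (R : ℝ) (ψ : M → E4) (χ : E4 → M),
    EndHyp M sf K R ψ χ →
    (∃ Φ : M ≃ₘ⟮𝓡 4, 𝓡 4⟯ E4,
      (∀ x v w, sf x ![v, w] =
        stdSymplecticForm (mfderiv (𝓡 4) 𝓘(ℝ, E4) Φ x v) (mfderiv (𝓡 4) 𝓘(ℝ, E4) Φ x w)) ∧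
      ∃ r : ℝ, R ≤ r ∧ ∀ w : E4, r < ‖w‖ → ∀ t : ℝ, 1 ≤ t → Φ (χ (t • w)) = t • Φ (χ w)) →
    Concl M sf ψ

/-- Composition (kernel-checked): conical chart + cone correction give the crux BY NAME. -/
theorem relEnd_of_conical (hL : LiouvilleConicalChart) (hC : ConeCorrection) :
    Summit.SmoothPoincare4.SmoothPoincare4.Theses.SymplecticOrigami.GromovRecognitionRelEnd := by
  rw [crux_iff]
  intro M _ _ _ _ _ _ sf K R ψ χ hyp
  exact hC M sf K R ψ χ hyp (hL M sf K R ψ χ hyp)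

end Summit.SmoothPoincare4.SmoothPoincare4.Cruxes.GromovRecognitionRelEnd.SketchIdeator3

end
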